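/-
Copyright (c) 2026 the pub-hodgecm-mathlib formalisation cell (harness21).  Prover seat hodgecm-mathlib-K2Liu-p11 (g3), Track B «K2-LIT»,
#184♮ = hLiu418 = `stmt-HodgeConjecture-24832`; organ (σ) A7-val, V6-inst TODO-3 (the `hBP` socket), FILE F4: EXISTENCE of the by-value frame data `(P, W, T, κ, x₀)` of
★ F3 `K2LiuIkedaFunctionalLeviLaw` ∕ ★ σ-7b at a non-split place.  THEOREMS ONLY (no `def`, no `instance`, no notation, no named-fact hypothesis, no `sorry`).
-/
import Summits.HodgeConjecture.HodgeConjecture.Theorems.K2LiuWittFrameLocalRing        -- ★ K2Liu-p07 p860951 (`exists_wittFrame_localRing`)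
import Summits.HodgeConjecture.HodgeConjecture.Theorems.K2LiuKRFrameInstanceDefs        -- ★ σ-2 p860974 (the CM currency: `Fp`, `imagUnit` letters; `thetaLoc`)
import Summits.HodgeConjecture.HodgeConjecture.Theorems.K2LiuLineStabBorelTransport     -- ★ F1 p861264 (brings `cmLocalForm`, `formCongr`, `cmLocalForm_eq_over`)
import Literature.NumberTheory.Automorphic.UnitaryGroupSymplecticCarriers               -- ★ `localForm_eq_map`
import HarnessLib

/-!
# Crux `HLiu418`, (σ) V6-inst TODO-3, FILE F4: A SLICE FRAME `P` OF `V′_v` TOGETHER WITH A BOREL FRAME `T` OF ITS INTEGRATED LINE, AT A NON-SPLIT PLACE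

Cell `hodgecm-mathlib`, crux item hLiu418 = `stmt-HodgeConjecture-24832` (helper lane `--supports`, count-neutral); squad K2 ∕ K2Liu, prover K2Liu-p11 (g3).

The (σ) face's small side (★ σ-2 `sectionB … P μX ω`, ★ σ-7b `hSiegS`) takes a Witt frame `(P, W, hW, hPJ)` BY VALUE (★ σ-7a `exists_sliceFrame`), and the `hBP` socket (★ F3
`sectionB_leviEquivSB_rhoLoc`) takes in addition a Borel frame `(T, κ, hT)` of the slice line `x₀ = P⁻¹e₀` with `P x₀ = e₀ = T x₀`.  This file supplies ALL of them at once at a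
non-split `v` (`c • w₀ = w₀`), so that ONE `obtain` feeds ★ σ-7b and ★ F3 with the SAME `P`:
* §1 (any field `K`, `a ≠ 0`) the matrix `S_a = [e₀ | a⁻¹e₂ | e₁] = !![1,0,0; 0,0,1; 0,a⁻¹,0]`: `Sᵀ · Φ₃ · S = a⁻¹ • W₀(a)` with `Φ₃ = !![0,0,1;0,1,0;1,0,0]`,
  `W₀(a) = !![0,1,0;1,0,0;0,0,a]` (`transpose_sFrame_mul_antidiag_mul_sFrame`), `det S_a = −a⁻¹`, `S_a e₀ = e₀`.
* §2 (CM, non-split `v`) **`exists_sliceFrame_borel`**: `∃ P W T κ x₀, W₀₀ = 0 ∧ (P^σ)ᵀ W P = J′_v ∧ IsUnit κ ∧ σ(T)ᵀ Φ₃ T = κ • J′_v ∧ P x₀ = e₀ ∧ T x₀ = e₀` for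
  `J′_v = ι(diag dV′)` the local form of `U(diag dV′)(L⁺_v)` and `Φ₃ = cmLocalForm L 3 v` — ★ K2Liu-p07 `exists_wittFrame_localRing` (`W = ι(W₀(a))`, `a = −d₀d₁d₂`),
  `T := ι(S_a) · P`, `κ := ι(a⁻¹)`, `x₀ := P⁻¹ e₀`.
References: [Scharlau1985HermitianForms, Ch. 7 §6]; [KudlaRallis1994, §1]; [Rogawski1990, §1.10 p. 9]; [PlatonovRapinchuk1994, §2.3].
HONEST LABEL: HC_CM is proved only modulo the 7 printed citations (2 remaining named inputs: hLiu418 = stmt-HodgeConjecture-24832,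
h413 = stmt-HodgeConjecture-24833) until rung 0 closes; count-neutral helper, closes no socket by itself.
-/

set_option autoImplicit false
set_option linter.dupNamespace false -- the mandated namespace repeats `HodgeConjecture.HodgeConjecture`

noncomputable section

open scoped Matrix
open NumberField IsDedekindDomain Matrix
open Literature.NumberTheory.Automorphic Literature.NumberTheory.Automorphic.UnitaryGroup
open Literature.NumberTheory.GelbartRogawski1991 Literature.NumberTheory.GelbartRogawski1991.GRConstruction
open Literature.NumberTheory.GelbartRogawski1991.UnitaryDualPair
open Summit.HodgeConjecture.HodgeConjecture.Cruxes.HLiu418.K2LiuWittFrameLocalRing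
open Summit.HodgeConjecture.HodgeConjecture.Cruxes.HLiu418.K2LiuLineStabBorelTransport

namespace Summit.HodgeConjecture.HodgeConjecture.Cruxes.HLiu418.K2LiuSliceLineBorelFrame

/-! ## §1 The matrix `S_a = [e₀ | a⁻¹e₂ | e₁]` over a field -/

section Field

variable {K : Type*} [Field K] {a : K} (ha : a ≠ 0)

include ha in
/-- **`S_aᵀ · Φ₃ · S_a = a⁻¹ • W₀(a)`**: the basis `(e₀, a⁻¹e₂, e₁)` turns Mok's `Φ₃` into `a⁻¹` times the Witt Gram `W₀(a) = [[0,1,0],[1,0,0],[0,0,a]]` of ★ K2Liu-p07.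
[cite: Rogawski1990, §1.10 p. 9] [cite: Scharlau1985HermitianForms, Ch. 7 §6] -/
theorem transpose_sFrame_mul_antidiag_mul_sFrame :
    (!![1, 0, 0; 0, 0, 1; 0, a⁻¹, 0] : Matrix (Fin 3) (Fin 3) K)ᵀ * !![0, 0, 1; 0, 1, 0; 1, 0, 0] * !![1, 0, 0; 0, 0, 1; 0, a⁻¹, 0] =
      a⁻¹ • (!![0, 1, 0; 1, 0, 0; 0, 0, a] : Matrix (Fin 3) (Fin 3) K) := by
  ext i j
  fin_cases i <;> fin_cases j <;> simp [Matrix.mul_apply, Fin.sum_univ_three, inv_mul_cancel₀ ha]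

/-- `det S_a = −a⁻¹`. [folklore] -/
theorem det_sFrame : (!![1, 0, 0; 0, 0, 1; 0, a⁻¹, 0] : Matrix (Fin 3) (Fin 3) K).det = -a⁻¹ := by
  rw [Matrix.det_fin_three]
  simp

/-- `S_a e₀ = e₀` (column `0`). [folklore] -/
theorem sFrame_mulVec_single : (!![1, 0, 0; 0, 0, 1; 0, a⁻¹, 0] : Matrix (Fin 3) (Fin 3) K) *ᵥ Pi.single 0 1 = Pi.single 0 1 := by
  rw [Matrix.mulVec_single_one]
  funext i
  fin_cases i <;> simp

/-- Mok's `Φ₃` over a field is `!![0,0,1;0,1,0;1,0,0]`. [cite: Rogawski1990, §1.10 p. 9] -/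
theorem antidiagonal_three_over_eq : (StdForm.antidiagonal 3).over K = !![0, 0, 1; 0, 1, 0; 1, 0, 0] := by
  ext i j
  rw [antidiagonal_three_over_apply]
  fin_cases i <;> fin_cases j <;> rfl

end Field

/-! ## §2 The CM instance at a non-split place -/

section CM

variable (L : Type) [Field L] [NumberField L] [IsCMField L] [Algebra.IsQuadraticExtension (Fp L) L]
  (dV' : Fin 3 → L) (hdV' : ∀ k, IsCMField.complexConj L (dV' k) = dV' k) (hdV'0 : ∀ k, dV' k ≠ 0)
  (v : HeightOneSpectrum (𝓞 (Fp L)))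

omit [Algebra.IsQuadraticExtension (Fp L) L] in
/-- a matrix with entries in `ι(F_v)` is fixed by `σ = c ⊗ 1`. [folklore] -/
theorem map_conjLocal_map_toLocalRing (M : Matrix (Fin 3) (Fin 3) (v.adicCompletion (Fp L))) :
    (M.map (toLocalRing L v)).map (conjLocal L (IsCMField.complexConj L) v) = M.map (toLocalRing L v) := by
  rw [Matrix.map_map]
  congr 1
  funext x
  exact conjLocal_toLocalRing (E := L) (IsCMField.complexConj L) v x

omit [IsCMField L] [Algebra.IsQuadraticExtension (Fp L) L] in
/-- `ι` on matrices commutes with scalars: `ι(r • M) = ι(r) • ι(M)`. [folklore] -/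
theorem map_toLocalRing_smul (r : v.adicCompletion (Fp L)) (M : Matrix (Fin 3) (Fin 3) (v.adicCompletion (Fp L))) :
    (r • M).map (toLocalRing L v) = toLocalRing L v r • M.map (toLocalRing L v) := by
  ext i j
  simp only [Matrix.map_apply, Matrix.smul_apply, smul_eq_mul, map_mul]

include hdV' hdV'0 in
/-- **A SLICE FRAME WITH A BOREL FRAME OF ITS LINE, AT A NON-SPLIT PLACE**: `∃ P W T κ x₀` with `W₀₀ = 0`, `(P^σ)ᵀ W P = J′_v` (★ σ-7a's `hPJ`), `κ` a unit,
`σ(T)ᵀ · Φ₃ · T = κ • J′_v` (★ F1∕F3's `hT`), `P x₀ = e₀`, `T x₀ = e₀` (`x₀ = P⁻¹e₀`, the integrated line of ★ σ-2 `thetaLoc P`) — ★ K2Liu-p07 `exists_wittFrame_localRing` + §1 with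
`a = −d₀d₁d₂`, `T = ι(S_a)·P`, `κ = ι(a⁻¹)`. [cite: Scharlau1985HermitianForms, Ch. 7 §6] [cite: KudlaRallis1994, §1] [cite: PlatonovRapinchuk1994, §2.3] -/
theorem exists_sliceFrame_borel (hc : IsCMField.complexConj L ≠ 1) (w₀ : PlacesOver L v) (hw₀ : IsCMField.complexConj L • w₀.1 = w₀.1) :
    ∃ (P : GL (Fin 3) (LocalRing L v)) (W : Matrix (Fin 3) (Fin 3) (LocalRing L v)) (T : GL (Fin 3) (LocalRing L v)) (κ : LocalRing L v) (x₀ : Fin 3 → LocalRing L v),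
      W 0 0 = 0 ∧
      (P.val.map (conjLocal L (IsCMField.complexConj L) v : LocalRing L v →+* LocalRing L v))ᵀ * W * P.val = (adelicForm L 3 (Matrix.diagonal dV')).map (adeleToLocal L v) ∧
      IsUnit κ ∧
      formCongr (conjLocal L (IsCMField.complexConj L) v) T (cmLocalForm L 3 v) = κ • (adelicForm L 3 (Matrix.diagonal dV')).map (adeleToLocal L v) ∧
      P.val *ᵥ x₀ = Pi.single 0 1 ∧ T.val *ᵥ x₀ = Pi.single 0 1 := by
  -- the real diagonal `d₀ : Fin 3 → L⁺` under `dV′` and its image `d` in `L⁺_v` (as ★ σ-7a `exists_sliceFrame`)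
  let d₀ : Fin 3 → Fp L := fun k => ⟨dV' k, (IsCMField.complexConj_eq_self_iff (K := L) _).1 (hdV' k)⟩
  let d : Fin 3 → v.adicCompletion (Fp L) := fun k => algebraMap (Fp L) (v.adicCompletion (Fp L)) (d₀ k)
  have hd0 : ∀ k, d k ≠ 0 := fun k => by
    have h0 : d₀ k ≠ 0 := fun h => hdV'0 k (by simpa [d₀] using congrArg Subtype.val h)
    exact (map_ne_zero_iff _ (algebraMap (Fp L) (v.adicCompletion (Fp L))).injective).2 h0
  have hJ' : (Matrix.diagonal d).map (toLocalRing L v) = (adelicForm L 3 (Matrix.diagonal dV')).map (adeleToLocal L v) := by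
    have hJ : Matrix.diagonal dV' = (Matrix.diagonal d₀).map (algebraMap (Fp L) L) := by
      rw [Matrix.diagonal_map (map_zero _)]
      rfl
    rw [localForm_eq_map L 3 v (Matrix.diagonal d₀) hJ]
    congr 1
    rw [Matrix.diagonal_map (map_zero _)]
  -- ★ K2Liu-p07's Witt frame `P` for `W₀(a)`, `a = −d₀d₁d₂`
  obtain ⟨P, hP⟩ := exists_wittFrame_localRing (IsCMField.complexConj L) hc (complexConj_imagUnit L) (imagUnit_ne_zero L) (imagUnit_mul_self L) v w₀ hw₀ d hd0
  set a : v.adicCompletion (Fp L) := -(d 0 * d 1 * d 2) with ha_def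
  have ha : a ≠ 0 := neg_ne_zero.2 (mul_ne_zero (mul_ne_zero (hd0 0) (hd0 1)) (hd0 2))
  -- the Borel frame `S = ι(S_a)`
  set SF : Matrix (Fin 3) (Fin 3) (v.adicCompletion (Fp L)) := !![1, 0, 0; 0, 0, 1; 0, a⁻¹, 0] with hSF
  have hSdet : IsUnit (SF.map (toLocalRing L v)).det := by
    rw [← RingHom.mapMatrix_apply, ← RingHom.map_det, det_sFrame]
    exact (isUnit_iff_ne_zero.2 (neg_ne_zero.2 (inv_ne_zero ha))).map _
  have hS : IsUnit (SF.map (toLocalRing L v)) := (Matrix.isUnit_iff_isUnit_det _).2 hSdet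
  refine ⟨P, _, hS.unit * P, toLocalRing L v a⁻¹, P⁻¹.val *ᵥ Pi.single 0 1, ?_, hP.trans hJ', (isUnit_iff_ne_zero.2 (inv_ne_zero ha)).map _, ?_, ?_, ?_⟩
  · rw [Matrix.map_apply]; simp
  · -- `σ(ιS · P)ᵀ Φ₃ (ιS · P) = σ(P)ᵀ (ιSᵀ Φ₃ ιS) P = σ(P)ᵀ (ι(a⁻¹) • ιW₀) P = ι(a⁻¹) • J′_v`
    have hΦ : cmLocalForm L 3 v = (!![0, 0, 1; 0, 1, 0; 1, 0, 0] : Matrix (Fin 3) (Fin 3) (v.adicCompletion (Fp L))).map (toLocalRing L v) := by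
      rw [cmLocalForm_eq_over, ← antidiagonal_three_over_eq, StdForm.over_map]
    have hmid : (SF.map (toLocalRing L v))ᵀ * cmLocalForm L 3 v * SF.map (toLocalRing L v) =
        toLocalRing L v a⁻¹ • ((!![0, 1, 0; 1, 0, 0; 0, 0, -(d 0 * d 1 * d 2)] : Matrix (Fin 3) (Fin 3) (v.adicCompletion (Fp L))).map (toLocalRing L v)) := by
      rw [hΦ, ← Matrix.transpose_map, ← RingHom.mapMatrix_apply, ← RingHom.mapMatrix_apply, ← RingHom.mapMatrix_apply, ← map_mul, ← map_mul,
        RingHom.mapMatrix_apply, hSF, transpose_sFrame_mul_antidiag_mul_sFrame ha, map_toLocalRing_smul, ← ha_def]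
    rw [formCongr, Units.val_mul, IsUnit.unit_spec, Matrix.map_mul, map_conjLocal_map_toLocalRing, Matrix.transpose_mul]
    calc (P.val.map (conjLocal L (IsCMField.complexConj L) v))ᵀ * (SF.map (toLocalRing L v))ᵀ * cmLocalForm L 3 v * (SF.map (toLocalRing L v) * P.val)
        = (P.val.map (conjLocal L (IsCMField.complexConj L) v))ᵀ * ((SF.map (toLocalRing L v))ᵀ * cmLocalForm L 3 v * SF.map (toLocalRing L v)) * P.val := by
          simp only [Matrix.mul_assoc]
      _ = toLocalRing L v a⁻¹ • ((P.val.map (conjLocal L (IsCMField.complexConj L) v))ᵀ *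
            ((!![0, 1, 0; 1, 0, 0; 0, 0, -(d 0 * d 1 * d 2)] : Matrix (Fin 3) (Fin 3) (v.adicCompletion (Fp L))).map (toLocalRing L v)) * P.val) := by
          rw [hmid, Matrix.mul_smul, Matrix.smul_mul]
      _ = toLocalRing L v a⁻¹ • (adelicForm L 3 (Matrix.diagonal dV')).map (adeleToLocal L v) := by rw [hP, hJ']
  · rw [Matrix.mulVec_mulVec, ← Units.val_mul, mul_inv_cancel, Units.val_one, Matrix.one_mulVec]
  · rw [Units.val_mul, IsUnit.unit_spec, Matrix.mulVec_mulVec, Matrix.mul_assoc, ← Units.val_mul, mul_inv_cancel, Units.val_one, Matrix.mul_one,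
      Matrix.mulVec_single_one]
    funext i
    rw [Matrix.col_apply, Matrix.map_apply, hSF]
    fin_cases i <;> simp

end CM

end Summit.HodgeConjecture.HodgeConjecture.Cruxes.HLiu418.K2LiuSliceLineBorelFrame

end
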